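import Mathlib
import Literature.MathematicalPhysics.StatisticalMechanics.BarlowCouplingDecay
import Summits.AtomisticToContinuum.Crystallization.Theorems.NashClassCertificatesNashNearFieldStubTriLandscapeTailsSplit

/-!
# Crux `NashNearField` (16827), stubs `stub_triLandscapeNear` / `stub_triLandscapeFar`: certified truncation III —
# `W(t; a, h) ≥ W_{K,F}(t; a, h) − TAIL(K, m₀)` (the finite evaluation behind every box of the branch and bound)

For `t` in the polynomial tube and a box cell (`47/50 ≤ a`, `39a/50 ≤ h`), retaining `K ≥ 1` layers on each side and, in each
retained layer `(δ, s)`, a finite index set `F δ s ⊇ {Q_δ < m₀}` (`m₀ ≥ 1`; `hcov`), the word-free functional is bounded BELOW by its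
finite truncation minus an explicit tail:
`W ≥ ½(Δ_F(0,0) + ∑_{k<K} μ_F⁺(k) + ∑_{k<K} μ_F⁻(k)) − ½(τ(0) + ∑_{k<K} τ(k+1) + ∑_{k<K} τ(−(k+1))) − (4/3)(C_d + C_r) K⁻³`,
`Δ_F(δ,s) = ∑_{F δ s} V_LJ(√q_t) − ∑_{F δ s} V_LJ‖layerVec a h δ s‖` (finite sums), `μ_F` their offset minima,
`τ(s)` = deformed + reference planar majorants at level `m₀` (`tri_sum_abs_deformed_le`, `tri_sum_abs_reference_le`),
`C_d = (κ_d⁻³/12 + 1/6)·10(κ_d⁻³ + ((16/25)κ_d²)⁻¹)`, `κ_d = 32/75`, and `C_r` likewise with `κ_r = (1833/2500)²`, `a₁² = (47/50)²`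
(`tri_wholeLayer_bound_le` + `∑_{n>K} n⁻⁴ ≤ (4/3)K⁻³`).  Stub piece `stub_triTruncation` (proved).  On a box of the parameters
`t`, the finite part is then handled term by term (each `V_LJ(√q)` is monotone in `q` on either side of `q = 1`).
-/

noncomputable section

open scoped BigOperators
open Literature.MathematicalPhysics.StatisticalMechanics Literature.Geometry.DiscreteGeometry

namespace Summit.AtomisticToContinuum.Crystallization.Theorems.NashClassCertificatesNashNearField

/-- `∑_{k} ((k + K + 1)⁴)⁻¹ ≤ (4/3) K⁻³` as a `tsum` bound (`K ≥ 1`). [folklore] -/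
theorem tri_tsum_inv_pow_four_tail_le {K : ℕ} (hK : 1 ≤ K) :
    ∑' k : ℕ, (((k + K + 1 : ℕ) : ℝ) ^ 4)⁻¹ ≤ 4 / 3 * ((K : ℝ) ^ 3)⁻¹ :=
  Real.tsum_le_of_sum_range_le (fun _ => by positivity) fun n => sum_inv_pow_four_tail_le hK n

/-- Summability of `k ↦ ((k + K + 1)⁴)⁻¹`. [folklore] -/
theorem tri_summable_inv_pow_four_shift (K : ℕ) :
    Summable fun k : ℕ => (((k + K + 1 : ℕ) : ℝ) ^ 4)⁻¹ := by
  have hs : Summable fun k : ℕ => (((k : ℕ) : ℝ) ^ 4)⁻¹ := (Real.summable_nat_pow_inv (p := 4)).2 (by norm_num)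
  exact ((summable_nat_add_iff (K + 1)).2 hs).congr fun k => by
    show ((((k + (K + 1) : ℕ) : ℝ)) ^ 4)⁻¹ = _
    rw [← add_assoc]

set_option maxHeartbeats 1000000 in
/-- **Stub piece `stub_triTruncation` (proved): the word-free functional is bounded below by its finite truncation minus an
explicit tail.** [folklore] -/
theorem stub_triTruncation :
    ∀ (t₀₀ t₀₁ t₀₂ t₁₁ t₁₂ t₂₂ a h : ℝ),
        (∀ x y z : ℝ, (4 / 5 : ℝ) ^ 2 * (x ^ 2 + y ^ 2 + z ^ 2) ≤
          (t₀₀ * x + t₀₁ * y + t₀₂ * z) ^ 2 + (t₁₁ * y + t₁₂ * z) ^ 2 + (t₂₂ * z) ^ 2 ∧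
        (t₀₀ * x + t₀₁ * y + t₀₂ * z) ^ 2 + (t₁₁ * y + t₁₂ * z) ^ 2 + (t₂₂ * z) ^ 2 ≤
          (6 / 5 : ℝ) ^ 2 * (x ^ 2 + y ^ 2 + z ^ 2)) →
        47 / 50 ≤ a → 39 / 50 * a ≤ h →
        ∀ (K : ℕ), 1 ≤ K → ∀ (m₀ : ℕ), 1 ≤ m₀ → ∀ (F : ℤ → ℤ → Finset (ℤ × ℤ)),
        (∀ (δ s : ℤ) (ij : ℤ × ℤ), ij ∉ F δ s → (m₀ : ℝ) ≤ (((ij.1 : ℝ) + ij.2 / 2 + δ / 2) ^ 2 + 3 / 4 * ((ij.2 : ℝ) + δ / 3) ^ 2)) →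
        (fun Δ : ℤ → ℤ → ℝ => (1 / 2 : ℝ) * (Δ 0 0 +
          (∑ k ∈ Finset.range K, if k = 0 then min (Δ 1 1) (Δ (-1) 1)
            else min (Δ 0 ((k : ℤ) + 1)) (min (Δ 1 ((k : ℤ) + 1)) (Δ (-1) ((k : ℤ) + 1)))) +
          (∑ k ∈ Finset.range K, if k = 0 then min (Δ 1 (-1)) (Δ (-1) (-1))
            else min (Δ 0 (-((k : ℤ) + 1))) (min (Δ 1 (-((k : ℤ) + 1))) (Δ (-1) (-((k : ℤ) + 1)))))))
        (fun δ s : ℤ => (∑ ij ∈ F δ s, lennardJones (Real.sqrt ((t₀₀ * ((ij.1 : ℝ) + (ij.2 : ℝ) / 2 + (δ : ℝ) / 2) + t₀₁ * (Real.sqrt 3 / 2 * ((ij.2 : ℝ) + (δ : ℝ) / 3)) + t₀₂ * ((s : ℝ) * (Real.sqrt 6 / 3))) ^ 2 + (t₁₁ * (Real.sqrt 3 / 2 * ((ij.2 : ℝ) + (δ : ℝ) / 3)) + t₁₂ * ((s : ℝ) * (Real.sqrt 6 / 3))) ^ 2 + (t₂₂ * ((s : ℝ) * (Real.sqrt 6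 / 3))) ^ 2))) - ∑ ij ∈ F δ s, lennardJones ‖layerVec a h δ s ij.1 ij.2‖) -
        ((fun τ : ℤ → ℝ => (1 / 2 : ℝ) * (τ 0 + (∑ k ∈ Finset.range K, τ ((k : ℤ) + 1)) +
          ∑ k ∈ Finset.range K, τ (-((k : ℤ) + 1)))) (fun s : ℤ => ((16 / 25 * (m₀ : ℝ) + 32 / 75 * (s : ℝ) ^ 2)⁻¹ ^ 3 / 12 + 1 / 6) *
        (10 * (((16 / 25 * (m₀ : ℝ) + 32 / 75 * (s : ℝ) ^ 2) ^ 3)⁻¹ +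
            1 / (16 / 25 * (16 / 25 * (m₀ : ℝ) + 32 / 75 * (s : ℝ) ^ 2) ^ 2)) +
          10 * m₀ * ((16 / 25 * (m₀ : ℝ) + 32 / 75 * (s : ℝ) ^ 2) ^ 3)⁻¹) +
      ((((47 / 50 : ℝ) ^ 2 * (m₀ : ℝ) + (s : ℝ) ^ 2 * (1833 / 2500 : ℝ) ^ 2)⁻¹ ^ 3 / 12 + 1 / 6) *
        (10 * ((((47 / 50 : ℝ) ^ 2 * (m₀ : ℝ) + (s : ℝ) ^ 2 * (1833 / 2500 : ℝ) ^ 2) ^ 3)⁻¹ +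
            1 / ((47 / 50 : ℝ) ^ 2 * ((47 / 50 : ℝ) ^ 2 * (m₀ : ℝ) + (s : ℝ) ^ 2 * (1833 / 2500 : ℝ) ^ 2) ^ 2)) +
          10 * m₀ * (((47 / 50 : ℝ) ^ 2 * (m₀ : ℝ) + (s : ℝ) ^ 2 * (1833 / 2500 : ℝ) ^ 2) ^ 3)⁻¹))) +
        4 / 3 * ((((32 / 75 : ℝ))⁻¹ ^ 3 / 12 + 1 / 6) * (10 * ((((32 / 75 : ℝ)) ^ 3)⁻¹ + ((16 / 25 : ℝ) * ((32 / 75 : ℝ)) ^ 2)⁻¹)) +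
          ((((1833 / 2500 : ℝ) ^ 2))⁻¹ ^ 3 / 12 + 1 / 6) * (10 * (((((1833 / 2500 : ℝ) ^ 2)) ^ 3)⁻¹ + ((47 / 50 : ℝ) ^ 2 * (((1833 / 2500 : ℝ) ^ 2)) ^ 2)⁻¹))) * (((K : ℝ)) ^ 3)⁻¹) ≤
        (fun Δ : ℤ → ℤ → ℝ => (1 / 2 : ℝ) * (Δ 0 0 +
            (∑' k : ℕ, if k = 0 then min (Δ 1 1) (Δ (-1) 1)
              else min (Δ 0 ((k : ℤ) + 1)) (min (Δ 1 ((k : ℤ) + 1)) (Δ (-1) ((k : ℤ) + 1)))) +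
            (∑' k : ℕ, if k = 0 then min (Δ 1 (-1)) (Δ (-1) (-1))
              else min (Δ 0 (-((k : ℤ) + 1))) (min (Δ 1 (-((k : ℤ) + 1))) (Δ (-1) (-((k : ℤ) + 1)))))))
          (fun δ s => (∑' ij : ℤ × ℤ, lennardJones (Real.sqrt ((t₀₀ * ((ij.1 : ℝ) + (ij.2 : ℝ) / 2 + (δ : ℝ) / 2) + t₀₁ * (Real.sqrt 3 / 2 * ((ij.2 : ℝ) + (δ : ℝ) / 3)) + t₀₂ * ((s : ℝ) * (Real.sqrt 6 / 3))) ^ 2 + (t₁₁ * (Real.sqrt 3 / 2 * ((ij.2 : ℝ) + (δ : ℝ) / 3)) + t₁₂ * ((s : ℝ) * (Real.sqrt 6 / 3))) ^ 2 + (t₂₂ * ((s : ℝ) * (Real.sqrt 6 / 3))) ^ 2))) -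
            layerInteraction lennardJones a h δ s) := by
  intro t₀₀ t₀₁ t₀₂ t₁₁ t₁₂ t₂₂ a h htube ha hh K hK m₀ hm₀ F hcov
  -- notation
  set Δ : ℤ → ℤ → ℝ := (fun δ s => (∑' ij : ℤ × ℤ, lennardJones (Real.sqrt ((t₀₀ * ((ij.1 : ℝ) + (ij.2 : ℝ) / 2 + (δ : ℝ) / 2) + t₀₁ * (Real.sqrt 3 / 2 * ((ij.2 : ℝ) + (δ : ℝ) / 3)) + t₀₂ * ((s : ℝ) * (Real.sqrt 6 / 3))) ^ 2 + (t₁₁ * (Real.sqrt 3 / 2 * ((ij.2 : ℝ) + (δ : ℝ) / 3)) + t₁₂ * ((s : ℝ) * (Real.sqrt 6 / 3))) ^ 2 + (t₂₂ * ((s : ℝ) * (Real.sqrt 6 / 3))) ^ 2))) - layerInteraction lennardJones a h δ s) with hΔ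
  set ΔF : ℤ → ℤ → ℝ := (fun δ s : ℤ => (∑ ij ∈ F δ s, lennardJones (Real.sqrt ((t₀₀ * ((ij.1 : ℝ) + (ij.2 : ℝ) / 2 + (δ : ℝ) / 2) + t₀₁ * (Real.sqrt 3 / 2 * ((ij.2 : ℝ) + (δ : ℝ) / 3)) + t₀₂ * ((s : ℝ) * (Real.sqrt 6 / 3))) ^ 2 + (t₁₁ * (Real.sqrt 3 / 2 * ((ij.2 : ℝ) + (δ : ℝ) / 3)) + t₁₂ * ((s : ℝ) * (Real.sqrt 6 / 3))) ^ 2 + (t₂₂ * ((s : ℝ) * (Real.sqrt 6 / 3))) ^ 2))) - ∑ ij ∈ F δ s, lennardJones ‖layerVec a h δ s ij.1 ij.2‖) with hΔF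
  set τ : ℤ → ℝ := (fun s : ℤ => ((16 / 25 * (m₀ : ℝ) + 32 / 75 * (s : ℝ) ^ 2)⁻¹ ^ 3 / 12 + 1 / 6) *
        (10 * (((16 / 25 * (m₀ : ℝ) + 32 / 75 * (s : ℝ) ^ 2) ^ 3)⁻¹ +
            1 / (16 / 25 * (16 / 25 * (m₀ : ℝ) + 32 / 75 * (s : ℝ) ^ 2) ^ 2)) +
          10 * m₀ * ((16 / 25 * (m₀ : ℝ) + 32 / 75 * (s : ℝ) ^ 2) ^ 3)⁻¹) +
      ((((47 / 50 : ℝ) ^ 2 * (m₀ : ℝ) + (s : ℝ) ^ 2 * (1833 / 2500 : ℝ) ^ 2)⁻¹ ^ 3 / 12 + 1 / 6) *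
        (10 * ((((47 / 50 : ℝ) ^ 2 * (m₀ : ℝ) + (s : ℝ) ^ 2 * (1833 / 2500 : ℝ) ^ 2) ^ 3)⁻¹ +
            1 / ((47 / 50 : ℝ) ^ 2 * ((47 / 50 : ℝ) ^ 2 * (m₀ : ℝ) + (s : ℝ) ^ 2 * (1833 / 2500 : ℝ) ^ 2) ^ 2)) +
          10 * m₀ * (((47 / 50 : ℝ) ^ 2 * (m₀ : ℝ) + (s : ℝ) ^ 2 * (1833 / 2500 : ℝ) ^ 2) ^ 3)⁻¹))) with hτ
  set Cd : ℝ := (((32 / 75 : ℝ))⁻¹ ^ 3 / 12 + 1 / 6) * (10 * ((((32 / 75 : ℝ)) ^ 3)⁻¹ + ((16 / 25 : ℝ) * ((32 / 75 : ℝ)) ^ 2)⁻¹)) with hCd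
  set Cr : ℝ := ((((1833 / 2500 : ℝ) ^ 2))⁻¹ ^ 3 / 12 + 1 / 6) * (10 * (((((1833 / 2500 : ℝ) ^ 2)) ^ 3)⁻¹ + ((47 / 50 : ℝ) ^ 2 * (((1833 / 2500 : ℝ) ^ 2)) ^ 2)⁻¹)) with hCr
  dsimp only
  have hm₀' : (0 : ℝ) < m₀ := by exact_mod_cast hm₀
  -- Step 1: retained layers, `Δ_F − τ ≤ Δ`
  have hstep1 : ∀ δ s : ℤ, (s ≠ 0 ∨ (δ = 0 ∧ s = 0)) → ΔF δ s - τ s ≤ Δ δ s := by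
    intro δ s hs
    have hβd : 0 < 16 / 25 * (m₀ : ℝ) + 32 / 75 * (s : ℝ) ^ 2 := by positivity
    have hβr : 0 < (47 / 50 : ℝ) ^ 2 * (m₀ : ℝ) + (s : ℝ) ^ 2 * (1833 / 2500 : ℝ) ^ 2 := by positivity
    have hm : ∀ u : Finset (ℤ × ℤ), Disjoint u (F δ s) → ∀ ij ∈ u,
        (m₀ : ℝ) ≤ ((ij.1 : ℝ) + ij.2 / 2 + δ / 2) ^ 2 + 3 / 4 * ((ij.2 : ℝ) + δ / 3) ^ 2 :=
      fun u hu ij hij => hcov δ s ij (Finset.disjoint_left.1 hu hij)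
    have hsd : Summable fun ij : ℤ × ℤ => lennardJones (Real.sqrt ((t₀₀ * ((ij.1 : ℝ) + (ij.2 : ℝ) / 2 + (δ : ℝ) / 2) + t₀₁ * (Real.sqrt 3 / 2 * ((ij.2 : ℝ) + (δ : ℝ) / 3)) + t₀₂ * ((s : ℝ) * (Real.sqrt 6 / 3))) ^ 2 + (t₁₁ * (Real.sqrt 3 / 2 * ((ij.2 : ℝ) + (δ : ℝ) / 3)) + t₁₂ * ((s : ℝ) * (Real.sqrt 6 / 3))) ^ 2 + (t₂₂ * ((s : ℝ) * (Real.sqrt 6 / 3))) ^ 2)) := by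
      rcases hs with hs | ⟨rfl, rfl⟩
      · exact tri_summable_deformed t₀₀ t₀₁ t₀₂ t₁₁ t₁₂ t₂₂ htube δ s hs
      · exact tri_summable_deformed_inLayer t₀₀ t₀₁ t₀₂ t₁₁ t₁₂ t₂₂ htube
    have hsr : Summable fun ij : ℤ × ℤ => lennardJones ‖layerVec a h δ s ij.1 ij.2‖ := by
      rcases hs with hs | ⟨rfl, rfl⟩
      · exact tri_summable_reference ha hh δ s hs
      · exact tri_summable_reference_inLayer ha hh
    have hd := (tri_sum_sub_le_tsum hsd (F δ s) fun u hu =>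
      tri_sum_abs_deformed_le t₀₀ t₀₁ t₀₂ t₁₁ t₁₂ t₂₂ htube δ s m₀ hβd u (hm u hu)).1
    have hr := (tri_sum_sub_le_tsum hsr (F δ s) fun u hu =>
      tri_sum_abs_reference_le ha hh δ s m₀ hβr u (hm u hu)).2
    simp only [hΔ, hΔF, hτ, layerInteraction]
    linarith
  -- Step 2: whole layers, `|Δ δ s| ≤ (C_d + C_r) (s²)⁻²` for `s ≠ 0`
  have hstep2 : ∀ δ s : ℤ, s ≠ 0 → |Δ δ s| ≤ (Cd + Cr) * (((s : ℝ) ^ 2) ^ 2)⁻¹ := by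
    intro δ s hs
    have hs2 : (0 : ℝ) < (s : ℝ) ^ 2 := by
      have : (s : ℝ) ≠ 0 := by exact_mod_cast hs
      positivity
    have hβd : 0 < 16 / 25 * ((0 : ℕ) : ℝ) + 32 / 75 * (s : ℝ) ^ 2 := by
      rw [Nat.cast_zero, mul_zero, zero_add]; positivity
    have hβr : 0 < (47 / 50 : ℝ) ^ 2 * ((0 : ℕ) : ℝ) + (s : ℝ) ^ 2 * (1833 / 2500 : ℝ) ^ 2 := by
      rw [Nat.cast_zero, mul_zero, zero_add]; positivity
    have hI := tri_abs_tsum_le_of_sum_abs_le fun u =>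
      tri_sum_abs_deformed_le t₀₀ t₀₁ t₀₂ t₁₁ t₁₂ t₂₂ htube δ s 0 hβd u fun ij _ => by rw [Nat.cast_zero]; positivity
    have hP := tri_abs_tsum_le_of_sum_abs_le fun u =>
      tri_sum_abs_reference_le ha hh δ s 0 hβr u fun ij _ => by rw [Nat.cast_zero]; positivity
    have hcd := tri_wholeLayer_bound_le (a₁sq := 16 / 25) (κ := 32 / 75) (by norm_num) (by norm_num) s hs
    have hcr' := tri_wholeLayer_bound_le (a₁sq := (47 / 50 : ℝ) ^ 2) (κ := (1833 / 2500 : ℝ) ^ 2)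
      (by norm_num) (by norm_num) s hs
    -- align the shapes `κ * s²` of the whole-layer lemma with the instances
    have eI : 16 / 25 * ((0 : ℕ) : ℝ) + 32 / 75 * (s : ℝ) ^ 2 = 16 / 25 * ((0 : ℕ) : ℝ) + 32 / 75 * (s : ℝ) ^ 2 := rfl
    have eP : (47 / 50 : ℝ) ^ 2 * ((0 : ℕ) : ℝ) + (s : ℝ) ^ 2 * (1833 / 2500 : ℝ) ^ 2 =
        (47 / 50 : ℝ) ^ 2 * ((0 : ℕ) : ℝ) + (1833 / 2500 : ℝ) ^ 2 * (s : ℝ) ^ 2 := by ring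
    rw [eP] at hP
    have hI' := hI.trans hcd
    have hP' := hP.trans hcr'
    simp only [hΔ, hCd, hCr, layerInteraction]
    have := abs_sub (∑' ij : ℤ × ℤ, lennardJones (Real.sqrt ((t₀₀ * ((ij.1 : ℝ) + (ij.2 : ℝ) / 2 + (δ : ℝ) / 2) + t₀₁ * (Real.sqrt 3 / 2 * ((ij.2 : ℝ) + (δ : ℝ) / 3)) + t₀₂ * ((s : ℝ) * (Real.sqrt 6 / 3))) ^ 2 + (t₁₁ * (Real.sqrt 3 / 2 * ((ij.2 : ℝ) + (δ : ℝ) / 3)) + t₁₂ * ((s : ℝ) * (Real.sqrt 6 / 3))) ^ 2 + (t₂₂ * ((s : ℝ) * (Real.sqrt 6 / 3))) ^ 2))) (∑' ij : ℤ × ℤ, lennardJones ‖layerVec a h δ s ij.1 ij.2‖)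
    nlinarith [hI', hP', this]

  -- Step 3: summability of the offset minima over the layer distance
  have hC0 : 0 ≤ Cd + Cr := by rw [hCd, hCr]; positivity
  have hg0 : Summable fun k : ℕ => 3 * (Cd + Cr) * ((((k : ℝ) + 1) ^ 2) ^ 2)⁻¹ := by
    refine ((tri_summable_inv_pow_four_shift 0).mul_left (3 * (Cd + Cr))).congr fun k => ?_
    push_cast; ring
  have hbd : ∀ (δ : ℤ) (k : ℕ), |Δ δ ((k : ℤ) + 1)| ≤ (Cd + Cr) * ((((k : ℝ) + 1) ^ 2) ^ 2)⁻¹ := by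
    intro δ k
    have h := hstep2 δ ((k : ℤ) + 1) (by omega)
    push_cast at h
    exact h
  have hbd' : ∀ (δ : ℤ) (k : ℕ), |Δ δ (-((k : ℤ) + 1))| ≤ (Cd + Cr) * ((((k : ℝ) + 1) ^ 2) ^ 2)⁻¹ := by
    intro δ k
    have h := hstep2 δ (-((k : ℤ) + 1)) (by omega)
    push_cast at h
    have e : ((-((k : ℝ) + 1)) ^ 2) ^ 2 = (((k : ℝ) + 1) ^ 2) ^ 2 := by ring
    rwa [e] at h
  have hXk : ∀ k : ℕ, 0 ≤ (Cd + Cr) * ((((k : ℝ) + 1) ^ 2) ^ 2)⁻¹ := fun k => by positivity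
  have hμs : Summable (fun k : ℕ => if k = 0 then min (Δ 1 1) (Δ (-1) 1)
            else min (Δ 0 ((k : ℤ) + 1)) (min (Δ 1 ((k : ℤ) + 1)) (Δ (-1) ((k : ℤ) + 1)))) := by
    refine Summable.of_norm_bounded hg0 fun k => ?_
    rw [Real.norm_eq_abs]
    split_ifs with hk
    · subst hk
      have h1 := hbd 1 0
      have h2 := hbd (-1) 0
      simp only [Nat.cast_zero, zero_add] at h1 h2 ⊢
      have := cbbc_abs_min_le (Δ 1 1) (Δ (-1) 1)
      linarith [hXk 0, h1, h2, this]
    · have := cbbc_abs_min_three_le (Δ 0 ((k : ℤ) + 1)) (Δ 1 ((k : ℤ) + 1)) (Δ (-1) ((k : ℤ) + 1))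
      linarith [hbd 0 k, hbd 1 k, hbd (-1) k]
  have hμs' : Summable (fun k : ℕ => if k = 0 then min (Δ 1 (-1)) (Δ (-1) (-1))
            else min (Δ 0 (-((k : ℤ) + 1))) (min (Δ 1 (-((k : ℤ) + 1))) (Δ (-1) (-((k : ℤ) + 1))))) := by
    refine Summable.of_norm_bounded hg0 fun k => ?_
    rw [Real.norm_eq_abs]
    split_ifs with hk
    · subst hk
      have h1 := hbd' 1 0
      have h2 := hbd' (-1) 0
      simp only [Nat.cast_zero, zero_add] at h1 h2 ⊢
      have := cbbc_abs_min_le (Δ 1 (-1)) (Δ (-1) (-1))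
      linarith [hXk 0, h1, h2, this]
    · have := cbbc_abs_min_three_le (Δ 0 (-((k : ℤ) + 1))) (Δ 1 (-((k : ℤ) + 1))) (Δ (-1) (-((k : ℤ) + 1)))
      linarith [hbd' 0 k, hbd' 1 k, hbd' (-1) k]
  -- Step 4: split off the layer tails and bound them
  have hsplit := (hμs.sum_add_tsum_nat_add K).symm
  have hsplit' := (hμs'.sum_add_tsum_nat_add K).symm
  have hcmp : Summable fun k : ℕ => -(Cd + Cr) * (((k + K + 1 : ℕ) : ℝ) ^ 4)⁻¹ :=
    (tri_summable_inv_pow_four_shift K).mul_left _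
  have hKtail := tri_tsum_inv_pow_four_tail_le hK
  have hpt : ∀ k : ℕ, -(Cd + Cr) * (((k + K + 1 : ℕ) : ℝ) ^ 4)⁻¹ ≤ (fun k : ℕ => if k = 0 then min (Δ 1 1) (Δ (-1) 1)
            else min (Δ 0 ((k : ℤ) + 1)) (min (Δ 1 ((k : ℤ) + 1)) (Δ (-1) ((k : ℤ) + 1)))) (k + K) := by
    intro k
    have hkK : k + K ≠ 0 := by omega
    simp only [hkK, if_false]
    have e : (((((k + K : ℕ) : ℤ) : ℝ) + 1) ^ 2) ^ 2 = (((k + K + 1 : ℕ) : ℝ)) ^ 4 := by push_cast; ring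
    have h0 := hbd 0 (k + K); have h1 := hbd 1 (k + K); have h2 := hbd (-1) (k + K)
    rw [show ((((k + K : ℕ) : ℝ)) + 1) = ((((k + K : ℕ) : ℤ) : ℝ) + 1) by push_cast; ring] at h0 h1 h2
    rw [e] at h0 h1 h2
    have a0 := neg_abs_le (Δ 0 (((k + K : ℕ) : ℤ) + 1))
    have a1 := neg_abs_le (Δ 1 (((k + K : ℕ) : ℤ) + 1))
    have a2 := neg_abs_le (Δ (-1) (((k + K : ℕ) : ℤ) + 1))
    refine le_min (by linarith) (le_min (by linarith) (by linarith))
  have hpt' : ∀ k : ℕ, -(Cd + Cr) * (((k + K + 1 : ℕ) : ℝ) ^ 4)⁻¹ ≤ (fun k : ℕ => if k = 0 then min (Δ 1 (-1)) (Δ (-1) (-1))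
            else min (Δ 0 (-((k : ℤ) + 1))) (min (Δ 1 (-((k : ℤ) + 1))) (Δ (-1) (-((k : ℤ) + 1))))) (k + K) := by
    intro k
    have hkK : k + K ≠ 0 := by omega
    simp only [hkK, if_false]
    have e : (((((k + K : ℕ) : ℤ) : ℝ) + 1) ^ 2) ^ 2 = (((k + K + 1 : ℕ) : ℝ)) ^ 4 := by push_cast; ring
    have h0 := hbd' 0 (k + K); have h1 := hbd' 1 (k + K); have h2 := hbd' (-1) (k + K)
    rw [show ((((k + K : ℕ) : ℝ)) + 1) = ((((k + K : ℕ) : ℤ) : ℝ) + 1) by push_cast; ring] at h0 h1 h2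
    rw [e] at h0 h1 h2
    have a0 := neg_abs_le (Δ 0 (-((((k + K : ℕ) : ℤ)) + 1)))
    have a1 := neg_abs_le (Δ 1 (-((((k + K : ℕ) : ℤ)) + 1)))
    have a2 := neg_abs_le (Δ (-1) (-((((k + K : ℕ) : ℤ)) + 1)))
    refine le_min (by linarith) (le_min (by linarith) (by linarith))
  have htail : -(Cd + Cr) * (4 / 3 * ((K : ℝ) ^ 3)⁻¹) ≤ ∑' k : ℕ, (fun k : ℕ => if k = 0 then min (Δ 1 1) (Δ (-1) 1)
            else min (Δ 0 ((k : ℤ) + 1)) (min (Δ 1 ((k : ℤ) + 1)) (Δ (-1) ((k : ℤ) + 1)))) (k + K) := by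
    have h1 := Summable.tsum_le_tsum hpt hcmp ((summable_nat_add_iff K).2 hμs)
    rw [tsum_mul_left] at h1
    have h2 := mul_le_mul_of_nonneg_left hKtail hC0
    linarith [h1, h2]
  have htail' : -(Cd + Cr) * (4 / 3 * ((K : ℝ) ^ 3)⁻¹) ≤ ∑' k : ℕ, (fun k : ℕ => if k = 0 then min (Δ 1 (-1)) (Δ (-1) (-1))
            else min (Δ 0 (-((k : ℤ) + 1))) (min (Δ 1 (-((k : ℤ) + 1))) (Δ (-1) (-((k : ℤ) + 1))))) (k + K) := by
    have h1 := Summable.tsum_le_tsum hpt' hcmp ((summable_nat_add_iff K).2 hμs')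
    rw [tsum_mul_left] at h1
    have h2 := mul_le_mul_of_nonneg_left hKtail hC0
    linarith [h1, h2]
  -- Step 5: the retained layers against the finite truncation
  have hret : (∑ k ∈ Finset.range K, (fun k : ℕ => if k = 0 then min (ΔF 1 1) (ΔF (-1) 1)
            else min (ΔF 0 ((k : ℤ) + 1)) (min (ΔF 1 ((k : ℤ) + 1)) (ΔF (-1) ((k : ℤ) + 1)))) k) - ∑ k ∈ Finset.range K, τ ((k : ℤ) + 1) ≤
      ∑ k ∈ Finset.range K, (fun k : ℕ => if k = 0 then min (Δ 1 1) (Δ (-1) 1)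
            else min (Δ 0 ((k : ℤ) + 1)) (min (Δ 1 ((k : ℤ) + 1)) (Δ (-1) ((k : ℤ) + 1)))) k := by
    rw [← Finset.sum_sub_distrib]
    refine Finset.sum_le_sum fun k _ => ?_
    split_ifs with hk
    · subst hk
      simp only [Nat.cast_zero, zero_add]
      rw [← min_sub_sub_right]
      exact min_le_min (hstep1 1 1 (Or.inl one_ne_zero)) (hstep1 (-1) 1 (Or.inl one_ne_zero))
    · rw [← min_sub_sub_right, ← min_sub_sub_right]
      exact min_le_min (hstep1 0 _ (Or.inl (by omega)))
        (min_le_min (hstep1 1 _ (Or.inl (by omega))) (hstep1 (-1) _ (Or.inl (by omega))))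
  have hret' : (∑ k ∈ Finset.range K, (fun k : ℕ => if k = 0 then min (ΔF 1 (-1)) (ΔF (-1) (-1))
            else min (ΔF 0 (-((k : ℤ) + 1))) (min (ΔF 1 (-((k : ℤ) + 1))) (ΔF (-1) (-((k : ℤ) + 1))))) k) - ∑ k ∈ Finset.range K, τ (-((k : ℤ) + 1)) ≤
      ∑ k ∈ Finset.range K, (fun k : ℕ => if k = 0 then min (Δ 1 (-1)) (Δ (-1) (-1))
            else min (Δ 0 (-((k : ℤ) + 1))) (min (Δ 1 (-((k : ℤ) + 1))) (Δ (-1) (-((k : ℤ) + 1))))) k := by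
    rw [← Finset.sum_sub_distrib]
    refine Finset.sum_le_sum fun k _ => ?_
    split_ifs with hk
    · subst hk
      simp only [Nat.cast_zero, zero_add]
      rw [← min_sub_sub_right]
      exact min_le_min (hstep1 1 (-1) (Or.inl (by norm_num))) (hstep1 (-1) (-1) (Or.inl (by norm_num)))
    · rw [← min_sub_sub_right, ← min_sub_sub_right]
      exact min_le_min (hstep1 0 _ (Or.inl (by omega)))
        (min_le_min (hstep1 1 _ (Or.inl (by omega))) (hstep1 (-1) _ (Or.inl (by omega))))
  have h00 := hstep1 0 0 (Or.inr ⟨rfl, rfl⟩)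
  -- Step 6: assemble
  have eμ : (∑' k : ℕ, (fun k : ℕ => if k = 0 then min (Δ 1 1) (Δ (-1) 1)
            else min (Δ 0 ((k : ℤ) + 1)) (min (Δ 1 ((k : ℤ) + 1)) (Δ (-1) ((k : ℤ) + 1)))) k) = (∑ k ∈ Finset.range K, (fun k : ℕ => if k = 0 then min (Δ 1 1) (Δ (-1) 1)
            else min (Δ 0 ((k : ℤ) + 1)) (min (Δ 1 ((k : ℤ) + 1)) (Δ (-1) ((k : ℤ) + 1)))) k) + ∑' k : ℕ, (fun k : ℕ => if k = 0 then min (Δ 1 1) (Δ (-1) 1)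
            else min (Δ 0 ((k : ℤ) + 1)) (min (Δ 1 ((k : ℤ) + 1)) (Δ (-1) ((k : ℤ) + 1)))) (k + K) := hsplit
  have eμ' : (∑' k : ℕ, (fun k : ℕ => if k = 0 then min (Δ 1 (-1)) (Δ (-1) (-1))
            else min (Δ 0 (-((k : ℤ) + 1))) (min (Δ 1 (-((k : ℤ) + 1))) (Δ (-1) (-((k : ℤ) + 1))))) k) = (∑ k ∈ Finset.range K, (fun k : ℕ => if k = 0 then min (Δ 1 (-1)) (Δ (-1) (-1))
            else min (Δ 0 (-((k : ℤ) + 1))) (min (Δ 1 (-((k : ℤ) + 1))) (Δ (-1) (-((k : ℤ) + 1))))) k) + ∑' k : ℕ, (fun k : ℕ => if k = 0 then min (Δ 1 (-1)) (Δ (-1) (-1))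
            else min (Δ 0 (-((k : ℤ) + 1))) (min (Δ 1 (-((k : ℤ) + 1))) (Δ (-1) (-((k : ℤ) + 1))))) (k + K) := hsplit'
  rw [eμ, eμ']
  linarith [hret, hret', htail, htail', h00, hC0]

end Summit.AtomisticToContinuum.Crystallization.Theorems.NashClassCertificatesNashNearField

end
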